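import Literature.Geometry.Symplectic.OrigamiFoldDefiningFunction
import Literature.Geometry.Symplectic.FoldFormsFourFoldsProofs
import Literature.Geometry.Symplectic.OrigamiFoldCollar
import Literature.Geometry.Symplectic.OrigamiFoldFirstOrderCalculus
import HarnessLib

/-!
# The first-order coefficient of `c^*ω` on the collar of the fold does not vanish on the null direction

Proofs companion of `OrigamiUnfolding.lean` (the named fact
`Literature.Geometry.Symplectic.exists_symplecticCutPieces_of_isOrigamiForm`, Cannas da
Silva–Guillemin–Pires, *Symplectic Origami*, IMRN 2011 = arXiv:0909.4065, Prop. 2.8; architecture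
in `OrigamiUnfoldingProofs.lean`), step (S1b).  On the kernel-adapted collar
`c = foldCollar U j : N × (-δ, δ) → M` of the fold (`OrigamiFoldCollar.lean`,
`OrigamiFoldCollarData.lean`) the pulled-back form decomposes as `c^*ω = A_t + dt ∧ B_t` with
`A₀ = j^*ω` and `B₀ = 0`; the Moser model `p^*i^*ω + d(t² p^*α)` of the proof of Prop. 2.8
(Cannas da Silva–Guillemin–Woodward 2000, Thm. 1) requires the first-order coefficient
`B₁ = ∂ₜ|₀ B_t` to be positive on the (oriented) null direction `X` — infinitesimally, this IS
the transversality clause "`ωⁿ` vanishes transversally on `Z`" of Def. 2.1.  This file proves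
`B₁(X) ≠ 0` for the tree's rendering `IsFoldedForm` (transversality through the chart Pfaffian):

* `exists_linearIndependent_triple`, `exists_adaptedFrame` — a frame
  `((e₁,0),(e₂,0),(v,0),(0,1))` of `ℝ³ × ℝ` adapted to a non-zero `v ∈ ℝ³`, as a linear
  isomorphism `T : ℝ⁴ → ℝ³ × ℝ`;
* `tangentCoordChange_round_trip` (round trip of tangent coordinate changes); a form is read
  through its chart representative by `MForm.inChart_apply_extChartAt`
  (`FormIntegrationCharts.lean`), using `contMDiffOn_pfaffian_inChart` of
  `FoldFormsFourFoldsProofs.lean`;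
* `IsFoldedForm.ker_mfderiv_eq_range_local` — local version of `ker dF = TZ` for a function
  vanishing on `j` near `n`;
* **`IsFoldedForm.hasDerivAt_pfaffian_inChart_fl`** — along the flow line `t ↦ Fl^ξ_t(j n)` of
  a unit field `U` of a function `f` vanishing on the fold, the chart Pfaffian
  `t ↦ Pf (ω.inChart (j n) (φ (Fl_t (j n))))` has a SIMPLE zero at `t = 0` (its derivative is
  `dG(ξ)` for the chart Pfaffian `G`, with `dG ≠ 0` killing exactly `TZ`, and `ξ ∉ TZ` because
  `ξ(f) = 1` while `df(TZ) = 0`);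
* `pfaffian_frame_eq_det_mul` — the Pfaffian of `(c^*ω)_{(n,t)}` in a frame `T` equals
  `det (L t) · Pf (ω.inChart (j n) (φ c(n,t)))`, `L t = dφ ∘ dc ∘ T` (functoriality
  `Pf(α ∘ L) = det L · Pf α`, `PfaffianFour.lean`); `det_frame_zero_ne_zero` (`L 0` bijective),
  `continuousAt_det_frame` (`t ↦ det (L t)` is continuous at `0`: `L t` is the Fréchet
  derivative of the smooth written map `φ ∘ c ∘ (ψ_n × id)⁻¹` at `(ψ_n n, t)` composed with `T`,
  the chart of `N × ℝ` at `(n, t)` being the one at `(n, 0)`);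
* `pfaffian_compContinuousLinearMap_eq` (the Pfaffian in a frame is the Pfaffian combination of
  the frame values; antisymmetry of a `2`-form is `Literature.Geometry.Kaehler.cam₂_swap`);
* **`IsFoldedForm.deriv_pullback_foldCollar_ne_zero`** — for a non-zero null vector `v` of
  `(j^*ω)_n` and a kernel-adapted unit field, `∂ₜ|₀ (c^*ω)_{(n,t)}((0,1),(v,0)) ≠ 0`: in the
  adapted frame five of the six Pfaffian coefficients vanish at `t = 0` (`ι_∂ₜ c^*ω = 0` and
  `v` null), so the frame Pfaffian `P` has `P'(0) = (j^*ω)(e₁,e₂) · ∂ₜ|₀(c^*ω)((v,0),(0,1))`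
  (`hasDerivAt_pfaffCombination`), while `P = det(L ·) · g` with `g` the chart Pfaffian along
  the flow line forces `P'(0) ≠ 0` (`hasDerivAt_ne_zero_of_eq_mul`);
* **`IsFoldedForm.deriv_pullback_foldCollar_orbit_ne_zero`** — the origami case: for fold data
  `(N, j, θ)` with a free circle action tangent to `ker ω` (Def. 2.2, the data of
  `IsOrigamiForm`), the orbit velocity `X_n` is a non-zero null vector (the null foliation is
  the vertical bundle of the null fibration, `OrigamiNullFoliation.lean`), hence
  `B₁(X_n) ≠ 0`.

Everything here is proved; no definitions, no named facts (D-0026).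

## References

* [CannasdasilvaGuilleminPires2010] A. Cannas da Silva, V. Guillemin, A. R. Pires, *Symplectic
  Origami*, IMRN 2011, 4252–4293 = arXiv:0909.4065, Def. 2.1–2.2, proof of Prop. 2.8 (Moser
  model).
* A. Cannas da Silva, V. Guillemin, C. Woodward, *On the unfolding of folded symplectic
  structures*, Math. Res. Lett. 7 (2000) 35–53, Thm. 1.
-/

noncomputable section

open scoped Manifold ContDiff Topology
open Set Function Filter
open Literature.Geometry.Kaehler Literature.Topology.FourManifolds

namespace Literature.Geometry.Symplectic

/-! ### Linear algebra: a frame of `ℝ³ × ℝ` adapted to a non-zero vector of `ℝ³` -/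

section Frame

/-- A non-zero vector of `ℝ³` is the last vector of a basis `(e₁, e₂, v)`. [folklore] -/
theorem exists_linearIndependent_triple (v : EuclideanSpace ℝ (Fin 3)) (hv : v ≠ 0) :
    ∃ e₁ e₂ : EuclideanSpace ℝ (Fin 3), LinearIndependent ℝ ![e₁, e₂, v] := by
  have h3 : Module.finrank ℝ (EuclideanSpace ℝ (Fin 3)) = 3 := finrank_euclideanSpace_fin
  have h1 : LinearIndependent ℝ ![v] := by
    rw [linearIndependent_unique_iff]
    exact hv
  obtain ⟨e₂, h2⟩ := exists_linearIndependent_cons_of_lt_finrank h1 (by rw [h3]; norm_num)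
  obtain ⟨e₁, h12⟩ := exists_linearIndependent_cons_of_lt_finrank h2 (by rw [h3]; norm_num)
  exact ⟨e₁, e₂, h12⟩

/-- **An adapted frame**: for `v ≠ 0` in `ℝ³` there is a linear isomorphism
`T : ℝ⁴ → ℝ³ × ℝ` sending the standard basis to `((e₁,0), (e₂,0), (v,0), (0,1))` with `(e₁, e₂, v)`
a basis of `ℝ³`. [folklore] -/
theorem exists_adaptedFrame (v : EuclideanSpace ℝ (Fin 3)) (hv : v ≠ 0) :
    ∃ T : EuclideanSpace ℝ (Fin 4) →L[ℝ] EuclideanSpace ℝ (Fin 3) × ℝ,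
      Function.Bijective T ∧ (T (stdVec 0)).2 = 0 ∧ (T (stdVec 1)).2 = 0 ∧
        T (stdVec 2) = (v, 0) ∧ T (stdVec 3) = (0, 1) := by
  obtain ⟨e₁, e₂, hind⟩ := exists_linearIndependent_triple v hv
  set A : EuclideanSpace ℝ (Fin 4) →L[ℝ] EuclideanSpace ℝ (Fin 3) :=
    (EuclideanSpace.proj (0 : Fin 4)).smulRight e₁ + (EuclideanSpace.proj (1 : Fin 4)).smulRight e₂ +
      (EuclideanSpace.proj (2 : Fin 4)).smulRight v with hA
  set B : EuclideanSpace ℝ (Fin 4) →L[ℝ] ℝ := EuclideanSpace.proj (3 : Fin 4) with hB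
  set T : EuclideanSpace ℝ (Fin 4) →L[ℝ] EuclideanSpace ℝ (Fin 3) × ℝ := A.prod B with hT
  have hTapply : ∀ x : EuclideanSpace ℝ (Fin 4), T x = (x 0 • e₁ + x 1 • e₂ + x 2 • v, x 3) := by
    intro x
    rfl
  -- injectivity from the linear independence of `(e₁, e₂, v)`
  have hinj : Function.Injective T := by
    refine (injective_iff_map_eq_zero T).2 fun x hx => ?_
    rw [hTapply, Prod.mk_eq_zero] at hx
    obtain ⟨hsum, h3⟩ := hx
    have hli := Fintype.linearIndependent_iff.1 hind (![x 0, x 1, x 2]) (by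
      simpa [Fin.sum_univ_succ, add_assoc] using hsum)
    have h0 : x 0 = 0 := hli 0
    have h1 : x 1 = 0 := hli 1
    have h2 : x 2 = 0 := hli 2
    ext i
    fin_cases i
    · exact h0
    · exact h1
    · exact h2
    · exact h3
  have hdim : Module.finrank ℝ (EuclideanSpace ℝ (Fin 4)) =
      Module.finrank ℝ (EuclideanSpace ℝ (Fin 3) × ℝ) := by
    rw [Module.finrank_prod, finrank_euclideanSpace_fin, finrank_euclideanSpace_fin,
      Module.finrank_self]
  have hsurj : Function.Surjective T := by
    have := (LinearMap.injective_iff_surjective_of_finrank_eq_finrank hdim (f := T.toLinearMap)).1 hinj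
    exact this
  refine ⟨T, ⟨hinj, hsurj⟩, ?_, ?_, ?_, ?_⟩ <;> simp [hTapply, stdVec_apply]

end Frame

/-! ### A form read through its chart representative -/

section ChartRead

variable {M : Type*} [TopologicalSpace M] [ChartedSpace (EuclideanSpace ℝ (Fin 4)) M]
  [IsManifold (𝓡 4) ∞ M]

/-- Round trip of tangent coordinate changes: `τ(x₀ → y) ∘ τ(y → x₀) = id` at `y`. [folklore] -/
theorem tangentCoordChange_round_trip (x₀ : M) {y : M} (hy : y ∈ (extChartAt (𝓡 4) x₀).source)
    (w : EuclideanSpace ℝ (Fin 4)) :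
    tangentCoordChange (𝓡 4) x₀ y y (tangentCoordChange (𝓡 4) y x₀ y w) = w := by
  have hmem : y ∈ (extChartAt (𝓡 4) y).source ∩ (extChartAt (𝓡 4) x₀).source ∩
      (extChartAt (𝓡 4) y).source := ⟨⟨mem_extChartAt_source y, hy⟩, mem_extChartAt_source y⟩
  rw [tangentCoordChange_comp hmem]
  exact tangentCoordChange_self (mem_extChartAt_source y)

-- A form read through its chart representative,
-- `(ω.inChart x₀ (φ y)) u = ω_y (τ(x₀ → y) ∘ u)`, is `MForm.inChart_apply_extChartAt`
-- (`Literature/NumberTheory/Transcendental/FormIntegrationCharts.lean`).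

end ChartRead

/-! ### The transversal derivative of the chart Pfaffian along the flow line -/

section FlowLine

universe u

variable {M : Type u} [TopologicalSpace M] [T2Space M] [CompactSpace M]
  [ChartedSpace (EuclideanSpace ℝ (Fin 4)) M] [IsManifold (𝓡 4) ∞ M]
variable {N : Type} [TopologicalSpace N] [ChartedSpace (EuclideanSpace ℝ (Fin 3)) N]
  [IsManifold (𝓡 3) ∞ N] {j : N → M} {s : MForm (𝓡 4) M ℝ 2}

omit [T2Space M] [CompactSpace M] in
/-- A local version of `ker df = TZ`: for a function `F` on `M`, differentiable at the fold point
`j n`, which vanishes on `j` near `n` and has `dF_{j n} ≠ 0`, the kernel of `dF_{j n}` is exactly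
`range dj_n`. [folklore] -/
theorem IsFoldedForm.ker_mfderiv_eq_range_local (h : IsFoldedForm s N j) {F : M → ℝ} (n : N)
    (hF : MDifferentiableAt (𝓡 4) 𝓘(ℝ, ℝ) F (j n))
    (hF0 : (F ∘ j) =ᶠ[𝓝 n] fun _ => 0) (hn : mfderiv (𝓡 4) 𝓘(ℝ, ℝ) F (j n) ≠ 0) :
    LinearMap.ker (mfderiv (𝓡 4) 𝓘(ℝ, ℝ) F (j n)).toLinearMap =
      LinearMap.range (mfderiv (𝓡 3) (𝓡 4) j n).toLinearMap := by
  -- `dF ∘ dj = 0`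
  have hj : MDifferentiableAt (𝓡 3) (𝓡 4) j n :=
    h.embedding.contMDiff.mdifferentiableAt (by norm_num)
  have hcomp : (mfderiv (𝓡 4) 𝓘(ℝ, ℝ) F (j n)).comp (mfderiv (𝓡 3) (𝓡 4) j n) = 0 := by
    rw [← mfderiv_comp n hF hj, hF0.mfderiv_eq]
    exact mfderiv_const
  have hle : LinearMap.range (mfderiv (𝓡 3) (𝓡 4) j n).toLinearMap ≤
      LinearMap.ker (mfderiv (𝓡 4) 𝓘(ℝ, ℝ) F (j n)).toLinearMap := by
    rintro _ ⟨v, rfl⟩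
    have : ((mfderiv (𝓡 4) 𝓘(ℝ, ℝ) F (j n)).comp (mfderiv (𝓡 3) (𝓡 4) j n)) v = 0 := by
      rw [hcomp]; rfl
    exact this
  obtain ⟨v, hv⟩ : ∃ v, mfderiv (𝓡 4) 𝓘(ℝ, ℝ) F (j n) v ≠ 0 := by
    by_contra hall
    push Not at hall
    exact hn (ContinuousLinearMap.ext hall)
  have hker : Module.finrank ℝ (LinearMap.ker (mfderiv (𝓡 4) 𝓘(ℝ, ℝ) F (j n)).toLinearMap) = 3 := by
    let L : EuclideanSpace ℝ (Fin 4) →ₗ[ℝ] ℝ := (mfderiv (𝓡 4) 𝓘(ℝ, ℝ) F (j n)).toLinearMap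
    let v' : EuclideanSpace ℝ (Fin 4) := v
    have hv' : L v' ≠ 0 := hv
    have hsurj : LinearMap.range L = ⊤ := by
      refine eq_top_iff.2 fun r _ => ⟨(r / L v') • v', ?_⟩
      rw [L.map_smul, smul_eq_mul, div_mul_cancel₀ r hv']
    have h1 := LinearMap.finrank_range_add_finrank_ker L
    rw [hsurj, finrank_top, Module.finrank_self, finrank_euclideanSpace_fin] at h1
    have h3 : Module.finrank ℝ (LinearMap.ker L) = 3 := by omega
    exact h3
  symm
  apply Submodule.eq_of_le_of_finrank_eq hle
  rw [h.finrank_range_mfderiv n]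
  exact hker.symm

/-- **The chart Pfaffian has a simple zero along the flow line through a fold point.** For fold
data `(N, j)`, a smooth function `f` vanishing on the fold and a unit field `U` of `f` (level `0`),
the function `t ↦ Pf (ω.inChart (j n) (φ (Fl^ξ_t (j n))))` vanishes at `t = 0` and has NON-ZERO
derivative there: its derivative is `dG(dφ ξ)` for the chart Pfaffian `G`, whose differential is
non-zero (`ω ∧ ω ⋔ 0`) and kills exactly `TZ`, while `ξ` is transverse to `Z` (`ξ(f) = 1`,
`df(TZ) = 0`). [cite: CannasdasilvaGuilleminPires2010, Def. 2.1 and proof of Prop. 2.8] -/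
theorem IsFoldedForm.hasDerivAt_pfaffian_inChart_fl (h : IsFoldedForm s N j) {f : M → ℝ}
    (U : LevelUnitField 3 f 0) (hf0 : ∀ x ∈ fold s, f x = 0) (n : N) :
    ∃ g' : ℝ, g' ≠ 0 ∧
      HasDerivAt (fun t : ℝ => pfaffian (s.inChart (j n) (extChartAt (𝓡 4) (j n) (U.fl (j n) t))))
        g' 0 ∧
      pfaffian (s.inChart (j n) (extChartAt (𝓡 4) (j n) (U.fl (j n) 0))) = 0 := by
  set x₀ := j n with hx₀
  set φ := extChartAt (𝓡 4) x₀ with hφ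
  have hx₀f : x₀ ∈ fold s := h.range_eq ▸ mem_range_self n
  -- the chart Pfaffian as a function on `M`, smooth near `x₀`
  set F : M → ℝ := fun y => pfaffian (s.inChart x₀ (φ y)) with hF
  have hFs : ContMDiffOn (𝓡 4) 𝓘(ℝ, ℝ) ∞ F φ.source := by
    rw [hφ, extChartAt_source]
    exact contMDiffOn_pfaffian_inChart h.smooth x₀
  have hsrc : φ.source ∈ 𝓝 x₀ := extChartAt_source_mem_nhds x₀
  have hFat : ContMDiffAt (𝓡 4) 𝓘(ℝ, ℝ) ∞ F x₀ := (hFs x₀ (mem_extChartAt_source x₀)).contMDiffAt hsrc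
  have hFd : MDifferentiableAt (𝓡 4) 𝓘(ℝ, ℝ) F x₀ := hFat.mdifferentiableAt (by norm_num)
  -- `dF_{x₀} ≠ 0`: it is `dG ∘ dφ` with `dφ_{x₀} = id` in the chart at `x₀`
  have hG : DifferentiableAt ℝ (fun e => pfaffian (s.inChart x₀ e)) (φ x₀) := by
    by_contra hnd
    exact h.transverse x₀ hx₀f (fderiv_zero_of_not_differentiableAt hnd)
  have hφd : HasMFDerivAt (𝓡 4) 𝓘(ℝ, EuclideanSpace ℝ (Fin 4)) φ x₀
      (tangentCoordChange (𝓡 4) x₀ x₀ x₀) := by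
    have hmd : MDifferentiableAt (𝓡 4) 𝓘(ℝ, EuclideanSpace ℝ (Fin 4)) φ x₀ :=
      ((contMDiffOn_extChartAt (n := ∞)).contMDiffAt
        ((chartAt _ x₀).open_source.mem_nhds (mem_chart_source _ x₀))).mdifferentiableAt
        (by norm_num)
    have := hmd.hasMFDerivAt
    rwa [mfderiv_extChartAt_eq_tangentCoordChange' x₀ (mem_extChartAt_source x₀)] at this
  have hFderiv : HasMFDerivAt (𝓡 4) 𝓘(ℝ, ℝ) F x₀
      ((fderiv ℝ (fun e => pfaffian (s.inChart x₀ e)) (φ x₀)).comp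
        (tangentCoordChange (𝓡 4) x₀ x₀ x₀)) := by
    have h1 : HasMFDerivAt 𝓘(ℝ, EuclideanSpace ℝ (Fin 4)) 𝓘(ℝ, ℝ) (fun e => pfaffian (s.inChart x₀ e))
        (φ x₀) (fderiv ℝ (fun e => pfaffian (s.inChart x₀ e)) (φ x₀)) :=
      hG.hasFDerivAt.hasMFDerivAt
    exact h1.comp x₀ hφd
  have hmfF : mfderiv (𝓡 4) 𝓘(ℝ, ℝ) F x₀ =
      (fderiv ℝ (fun e => pfaffian (s.inChart x₀ e)) (φ x₀)).comp
        (tangentCoordChange (𝓡 4) x₀ x₀ x₀) := hFderiv.mfderiv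
  have hmfF_apply : ∀ w : EuclideanSpace ℝ (Fin 4),
      mfderiv (𝓡 4) 𝓘(ℝ, ℝ) F x₀ w = fderiv ℝ (fun e => pfaffian (s.inChart x₀ e)) (φ x₀) w := by
    intro w
    rw [hmfF]
    change fderiv ℝ (fun e => pfaffian (s.inChart x₀ e)) (φ x₀)
      (tangentCoordChange (𝓡 4) x₀ x₀ x₀ w) = _
    rw [tangentCoordChange_self (mem_extChartAt_source x₀)]
  have hFn : mfderiv (𝓡 4) 𝓘(ℝ, ℝ) F x₀ ≠ 0 := by
    intro h0
    apply h.transverse x₀ hx₀f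
    ext w
    rw [← hmfF_apply w, h0]
    rfl
  -- `F ∘ j = 0` near `n`
  have hF0 : (F ∘ j) =ᶠ[𝓝 n] fun _ => 0 := by
    have hcont : ContinuousAt j n := h.embedding.contMDiff.continuous.continuousAt
    filter_upwards [hcont.preimage_mem_nhds hsrc] with m hm
    have hmf : j m ∈ fold s := h.range_eq ▸ mem_range_self m
    exact (mem_fold_iff_pfaffian_inChart s x₀ hm).1 hmf
  -- `ξ(x₀) ∉ range dj_n`, since `df(ξ) = 1` and `df ∘ dj = 0`
  have hfd : MDifferentiable (𝓡 4) 𝓘(ℝ, ℝ) f := U.contMDiff_f.mdifferentiable (by norm_num)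
  have hξ : (U.ξ x₀ : EuclideanSpace ℝ (Fin 4)) ∉ Set.range (mfderiv (𝓡 3) (𝓡 4) j n) := by
    rintro ⟨v, hv⟩
    have h1 : mfderiv (𝓡 4) 𝓘(ℝ, ℝ) f x₀ (mfderiv (𝓡 3) (𝓡 4) j n v) = 0 :=
      h.mfderiv_apply_mfderiv_eq_zero hfd hf0 n v
    have h2 : mlineDeriv (𝓡 4) f x₀ (U.ξ x₀) = 1 :=
      U.mlineDeriv_eq_one x₀ (by rw [hf0 x₀ hx₀f]; exact ⟨by linarith [U.δ_pos], by linarith [U.δ_pos]⟩)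
    rw [mlineDeriv_def] at h2
    have hv' : (mfderiv (𝓡 3) (𝓡 4) j n v : EuclideanSpace ℝ (Fin 4)) = U.ξ x₀ := hv
    rw [hv'] at h1
    rw [h1] at h2
    have h2' : (0 : ℝ) = 1 := h2
    exact zero_ne_one h2'
  -- hence `dF_{x₀}(ξ) ≠ 0`
  have hker := h.ker_mfderiv_eq_range_local n hFd hF0 hFn
  have hFξ : mfderiv (𝓡 4) 𝓘(ℝ, ℝ) F x₀ (U.ξ x₀) ≠ 0 := by
    intro h0
    apply hξ
    have : (U.ξ x₀ : EuclideanSpace ℝ (Fin 4)) ∈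
        LinearMap.ker (mfderiv (𝓡 4) 𝓘(ℝ, ℝ) F x₀).toLinearMap := h0
    rw [hker, LinearMap.mem_range] at this
    obtain ⟨v, hv⟩ := this
    exact ⟨v, hv⟩
  -- the flow line: `t ↦ Fl_t x₀` has velocity `ξ` at `0`; differentiate `F` along it
  have hcurve : HasMFDerivAt 𝓘(ℝ, ℝ) (𝓡 4) (U.fl x₀) 0
      ((1 : ℝ →L[ℝ] ℝ).smulRight (U.ξ (U.fl x₀ 0))) := isMIntegralCurve_flow U.contMDiff x₀ 0
  have hFd' : MDifferentiableAt (𝓡 4) 𝓘(ℝ, ℝ) F (U.fl x₀ 0) := by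
    rw [U.fl_zero]; exact hFd
  have h1 : HasMFDerivAt 𝓘(ℝ, ℝ) 𝓘(ℝ, ℝ) (F ∘ U.fl x₀) 0
      ((mfderiv (𝓡 4) 𝓘(ℝ, ℝ) F (U.fl x₀ 0)).comp ((1 : ℝ →L[ℝ] ℝ).smulRight (U.ξ (U.fl x₀ 0)))) :=
    hFd'.hasMFDerivAt.comp 0 hcurve
  have h2 : HasFDerivAt (F ∘ U.fl x₀)
      ((mfderiv (𝓡 4) 𝓘(ℝ, ℝ) F (U.fl x₀ 0)).comp ((1 : ℝ →L[ℝ] ℝ).smulRight (U.ξ (U.fl x₀ 0)))) 0 :=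
    hasMFDerivAt_iff_hasFDerivAt.1 h1
  have h3 : ((mfderiv (𝓡 4) 𝓘(ℝ, ℝ) F (U.fl x₀ 0)).comp ((1 : ℝ →L[ℝ] ℝ).smulRight (U.ξ (U.fl x₀ 0))) :
      ℝ →L[ℝ] ℝ) = (1 : ℝ →L[ℝ] ℝ).smulRight (mlineDeriv (𝓡 4) F (U.fl x₀ 0) (U.ξ (U.fl x₀ 0))) := by
    apply ContinuousLinearMap.ext_ring
    show (mfderiv (𝓡 4) 𝓘(ℝ, ℝ) F (U.fl x₀ 0)) (((1 : ℝ →L[ℝ] ℝ) (1 : ℝ)) • U.ξ (U.fl x₀ 0)) =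
      ((1 : ℝ →L[ℝ] ℝ) (1 : ℝ)) • mlineDeriv (𝓡 4) F (U.fl x₀ 0) (U.ξ (U.fl x₀ 0))
    simp [mlineDeriv]
  have hderiv0 : HasDerivAt (F ∘ U.fl x₀) (mlineDeriv (𝓡 4) F (U.fl x₀ 0) (U.ξ (U.fl x₀ 0))) 0 :=
    hasDerivAt_iff_hasFDerivAt.2 (h2.congr_fderiv h3)
  have hscalar : mlineDeriv (𝓡 4) F (U.fl x₀ 0) (U.ξ (U.fl x₀ 0)) =
      mfderiv (𝓡 4) 𝓘(ℝ, ℝ) F x₀ (U.ξ x₀) := by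
    rw [U.fl_zero]
  have hderiv : HasDerivAt (fun t : ℝ => pfaffian (s.inChart (j n) (extChartAt (𝓡 4) (j n) (U.fl (j n) t))))
      (mfderiv (𝓡 4) 𝓘(ℝ, ℝ) F x₀ (U.ξ x₀)) 0 := by
    rw [← hscalar]
    exact hderiv0
  refine ⟨mfderiv (𝓡 4) 𝓘(ℝ, ℝ) F x₀ (U.ξ x₀), hFξ, hderiv, ?_⟩
  rw [U.fl_zero]
  exact (mem_fold_iff_pfaffian_inChart_self s x₀).1 hx₀f

end FlowLine

/-! ### The frame along the collar: factorisation and continuity of the determinant -/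

section FrameDet

universe u

variable {M : Type u} [TopologicalSpace M] [T2Space M] [CompactSpace M]
  [ChartedSpace (EuclideanSpace ℝ (Fin 4)) M] [IsManifold (𝓡 4) ∞ M]
variable {N : Type} [TopologicalSpace N] [ChartedSpace (EuclideanSpace ℝ (Fin 3)) N]
  [IsManifold (𝓡 3) ∞ N] {j : N → M} {s : MForm (𝓡 4) M ℝ 2}

omit [IsManifold (𝓡 3) ∞ N] in
/-- **Factorisation of the frame Pfaffian.** Along the collar `c = foldCollar U j` and for a
linear map `T : ℝ⁴ → ℝ³ × ℝ`, whenever `c(n, t)` lies in the domain of the chart `φ` at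
`x₀ = j n` the Pfaffian of `(c^*ω)_{(n,t)}` in the frame `T` is `det (L t) · Pf (ω.inChart x₀ (φ c(n,t)))`
with `L t = dφ ∘ dc ∘ T` (functoriality of the Pfaffian). [folklore] -/
theorem pfaffian_frame_eq_det_mul {f : M → ℝ} (U : LevelUnitField 3 f 0) (n : N) (t : ℝ)
    (T : EuclideanSpace ℝ (Fin 4) →L[ℝ] EuclideanSpace ℝ (Fin 3) × ℝ)
    (ht : foldCollar U j (n, t) ∈ (extChartAt (𝓡 4) (j n)).source) :
    pfaffian (((s.pullback ((𝓡 3).prod 𝓘(ℝ, ℝ)) (foldCollar U j)) (n, t)).compContinuousLinearMap T) =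
      LinearMap.det ((((tangentCoordChange (𝓡 4) (foldCollar U j (n, t)) (j n)
            (foldCollar U j (n, t))).comp
          (mfderiv ((𝓡 3).prod 𝓘(ℝ, ℝ)) (𝓡 4) (foldCollar U j) (n, t))).comp T :
          EuclideanSpace ℝ (Fin 4) →L[ℝ] EuclideanSpace ℝ (Fin 4)) :
          EuclideanSpace ℝ (Fin 4) →ₗ[ℝ] EuclideanSpace ℝ (Fin 4)) *
        pfaffian (s.inChart (j n) (extChartAt (𝓡 4) (j n) (foldCollar U j (n, t)))) := by
  rw [← pfaffian_compContinuousLinearMap]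
  congr 1
  ext w
  -- both sides evaluate `ω_{c(n,t)}` on `dc (T wᵢ)`
  have hR := MForm.inChart_apply_extChartAt s ht
    (fun i => ((tangentCoordChange (𝓡 4) (foldCollar U j (n, t)) (j n) (foldCollar U j (n, t))).comp
      (mfderiv ((𝓡 3).prod 𝓘(ℝ, ℝ)) (𝓡 4) (foldCollar U j) (n, t))) (T (w i)))
  change s (foldCollar U j (n, t)) (fun i => mfderiv ((𝓡 3).prod 𝓘(ℝ, ℝ)) (𝓡 4) (foldCollar U j) (n, t) (T (w i))) =
    s.inChart (j n) (extChartAt (𝓡 4) (j n) (foldCollar U j (n, t)))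
      (fun i => ((tangentCoordChange (𝓡 4) (foldCollar U j (n, t)) (j n) (foldCollar U j (n, t))).comp
        (mfderiv ((𝓡 3).prod 𝓘(ℝ, ℝ)) (𝓡 4) (foldCollar U j) (n, t))) (T (w i)))
  rw [hR]
  congr 1
  funext i
  change _ = tangentCoordChange (𝓡 4) (j n) (foldCollar U j (n, t)) (foldCollar U j (n, t))
    (tangentCoordChange (𝓡 4) (foldCollar U j (n, t)) (j n) (foldCollar U j (n, t))
      (mfderiv ((𝓡 3).prod 𝓘(ℝ, ℝ)) (𝓡 4) (foldCollar U j) (n, t) (T (w i))))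
  exact (tangentCoordChange_round_trip (j n) ht _).symm

/-- At `t = 0` the frame map `L 0 = dφ_{x₀} ∘ dc_{(n,0)} ∘ T` is bijective for bijective `T`
(`dφ_{x₀} = id` in its own chart, `dc` bijective on the band). [folklore] -/
theorem det_frame_zero_ne_zero (h : IsFoldedForm s N j) {f : M → ℝ} (U : LevelUnitField 3 f 0)
    (hf0 : ∀ x ∈ fold s, f x = 0) (n : N)
    (T : EuclideanSpace ℝ (Fin 4) →L[ℝ] EuclideanSpace ℝ (Fin 3) × ℝ) (hT : Function.Bijective T) :
    LinearMap.det ((((tangentCoordChange (𝓡 4) (foldCollar U j (n, 0)) (j n)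
            (foldCollar U j (n, 0))).comp
          (mfderiv ((𝓡 3).prod 𝓘(ℝ, ℝ)) (𝓡 4) (foldCollar U j) (n, 0))).comp T :
          EuclideanSpace ℝ (Fin 4) →L[ℝ] EuclideanSpace ℝ (Fin 4)) :
          EuclideanSpace ℝ (Fin 4) →ₗ[ℝ] EuclideanSpace ℝ (Fin 4)) ≠ 0 := by
  have hj0 : ∀ m, f (j m) = 0 := fun m => hf0 _ (h.range_eq ▸ mem_range_self m)
  have hc : Function.Bijective (mfderiv ((𝓡 3).prod 𝓘(ℝ, ℝ)) (𝓡 4) (foldCollar U j) (n, 0)) :=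
    bijective_mfderiv_foldCollar U h.embedding hj0 n ⟨by linarith [U.δ_pos], U.δ_pos⟩
  have htcc : ∀ w : EuclideanSpace ℝ (Fin 4),
      tangentCoordChange (𝓡 4) (foldCollar U j (n, 0)) (j n) (foldCollar U j (n, 0)) w = w := by
    intro w
    have h0 : foldCollar U j (n, 0) = j n := foldCollar_zero U j n
    rw [h0]
    exact tangentCoordChange_self (mem_extChartAt_source (j n))
  set L : EuclideanSpace ℝ (Fin 4) →ₗ[ℝ] EuclideanSpace ℝ (Fin 4) :=
    ((((tangentCoordChange (𝓡 4) (foldCollar U j (n, 0)) (j n) (foldCollar U j (n, 0))).comp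
      (mfderiv ((𝓡 3).prod 𝓘(ℝ, ℝ)) (𝓡 4) (foldCollar U j) (n, 0))).comp T :
      EuclideanSpace ℝ (Fin 4) →L[ℝ] EuclideanSpace ℝ (Fin 4)) :
      EuclideanSpace ℝ (Fin 4) →ₗ[ℝ] EuclideanSpace ℝ (Fin 4)) with hL
  have hLapply : ∀ x, L x = mfderiv ((𝓡 3).prod 𝓘(ℝ, ℝ)) (𝓡 4) (foldCollar U j) (n, 0) (T x) := by
    intro x
    exact htcc _
  have hLbij : Function.Bijective L := by
    have e : (L : EuclideanSpace ℝ (Fin 4) → EuclideanSpace ℝ (Fin 4)) =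
        (mfderiv ((𝓡 3).prod 𝓘(ℝ, ℝ)) (𝓡 4) (foldCollar U j) (n, 0)) ∘ T := funext hLapply
    rw [e]
    exact hc.comp hT
  have hunit := (LinearEquiv.ofBijective L hLbij).isUnit_det'
  exact hunit.ne_zero

/-- **Continuity in `t` of the frame determinant at `t = 0`.** The frame map
`L t = dφ_{c(n,t)} ∘ dc_{(n,t)} ∘ T` is, for `t` near `0`, the Fréchet derivative of the smooth
written map `Φ̂ = φ ∘ c ∘ (ψ_n × id)⁻¹` at `(ψ_n n, t)` composed with `T` (chain rule; the chart
of `N × ℝ` at `(n, t)` is the one at `(n, 0)`), so `t ↦ det (L t)` is continuous at `0`. [folklore] -/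
theorem continuousAt_det_frame (h : IsFoldedForm s N j) {f : M → ℝ} (U : LevelUnitField 3 f 0)
    (n : N) (T : EuclideanSpace ℝ (Fin 4) →L[ℝ] EuclideanSpace ℝ (Fin 3) × ℝ) :
    ContinuousAt (fun t : ℝ =>
      LinearMap.det ((((tangentCoordChange (𝓡 4) (foldCollar U j (n, t)) (j n)
            (foldCollar U j (n, t))).comp
          (mfderiv ((𝓡 3).prod 𝓘(ℝ, ℝ)) (𝓡 4) (foldCollar U j) (n, t))).comp T :
          EuclideanSpace ℝ (Fin 4) →L[ℝ] EuclideanSpace ℝ (Fin 4)) :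
          EuclideanSpace ℝ (Fin 4) →ₗ[ℝ] EuclideanSpace ℝ (Fin 4))) 0 := by
  set x₀ := j n with hx₀
  set φ := extChartAt (𝓡 4) x₀ with hφ
  set c := foldCollar U j with hc
  have hj : ContMDiff (𝓡 3) (𝓡 4) ∞ j := h.embedding.contMDiff
  have hcs : ContMDiff ((𝓡 3).prod 𝓘(ℝ, ℝ)) (𝓡 4) ∞ c := contMDiff_foldCollar U hj
  -- the open set where `c` maps into the chart domain
  set O : Set (N × ℝ) := c ⁻¹' φ.source with hO
  have hOo : IsOpen O := (isOpen_extChartAt_source x₀).preimage hcs.continuous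
  have hO0 : ((n, (0 : ℝ)) : N × ℝ) ∈ O := by
    change c (n, 0) ∈ φ.source
    rw [hc, foldCollar_zero]
    exact mem_extChartAt_source x₀
  -- `Φ = φ ∘ c` is smooth on `O`
  set Φ : N × ℝ → EuclideanSpace ℝ (Fin 4) := φ ∘ c with hΦ
  have hΦs : ContMDiffOn ((𝓡 3).prod 𝓘(ℝ, ℝ)) 𝓘(ℝ, EuclideanSpace ℝ (Fin 4)) ∞ Φ O := by
    have h1 : ContMDiffOn (𝓡 4) 𝓘(ℝ, EuclideanSpace ℝ (Fin 4)) ∞ φ φ.source := by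
      rw [hφ, extChartAt_source]
      exact contMDiffOn_extChartAt
    exact h1.comp hcs.contMDiffOn fun p hp => hp
  -- the chart of `N × ℝ` at `(n, 0)` and the written map
  set Ψ := extChartAt ((𝓡 3).prod 𝓘(ℝ, ℝ)) ((n, (0 : ℝ)) : N × ℝ) with hΨ
  set W : EuclideanSpace ℝ (Fin 3) × ℝ → EuclideanSpace ℝ (Fin 4) := Φ ∘ Ψ.symm with hW
  -- `W` is `C^∞` on the open set `Ψ.target ∩ Ψ.symm ⁻¹' O`
  set D : Set (EuclideanSpace ℝ (Fin 3) × ℝ) := Ψ.target ∩ Ψ.symm ⁻¹' O with hD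
  have hDo : IsOpen D := by
    have := (continuousOn_extChartAt_symm ((n, (0 : ℝ)) : N × ℝ)).isOpen_inter_preimage
      (isOpen_extChartAt_target (I := (𝓡 3).prod 𝓘(ℝ, ℝ)) _) hOo
    exact this
  have hWs : ContDiffOn ℝ ∞ W D := by
    have := (contMDiffOn_iff.1 hΦs).2 ((n, (0 : ℝ)) : N × ℝ) (0 : EuclideanSpace ℝ (Fin 4))
    have hsrc : (extChartAt 𝓘(ℝ, EuclideanSpace ℝ (Fin 4)) (0 : EuclideanSpace ℝ (Fin 4))).source =
        univ := by simp
    rw [hsrc, preimage_univ, inter_univ] at this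
    exact this.congr fun y _ => rfl
  -- the line `t ↦ (ψ n, t)` stays in `D` near `0`
  have hline : Continuous fun t : ℝ => ((extChartAt (𝓡 3) n n, t) : EuclideanSpace ℝ (Fin 3) × ℝ) :=
    continuous_const.prodMk continuous_id
  have hΨapply : ∀ t : ℝ, Ψ (n, t) = (extChartAt (𝓡 3) n n, t) := fun t => by
    rw [hΨ, ← extChartAt_prod_real_eq n t]
    exact extChartAt_prod_real_apply n n t t
  have hD0 : ((extChartAt (𝓡 3) n n, (0 : ℝ)) : EuclideanSpace ℝ (Fin 3) × ℝ) ∈ D := by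
    rw [← hΨapply 0]
    exact ⟨mem_extChartAt_target _, by
      change Ψ.symm (Ψ (n, 0)) ∈ O
      rw [extChartAt_to_inv]
      exact hO0⟩
  have hDt : ∀ᶠ t in 𝓝 (0 : ℝ), ((extChartAt (𝓡 3) n n, t) : EuclideanSpace ℝ (Fin 3) × ℝ) ∈ D :=
    hline.continuousAt.preimage_mem_nhds (hDo.mem_nhds hD0)
  have hOt : ∀ᶠ t in 𝓝 (0 : ℝ), ((n, t) : N × ℝ) ∈ O :=
    (continuous_const.prodMk continuous_id : Continuous fun t : ℝ => ((n, t) : N × ℝ)).continuousAt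
      |>.preimage_mem_nhds (hOo.mem_nhds hO0)
  -- for such `t`: the frame map is `(fderiv W (ψ n, t)).comp T`
  have hframe : ∀ᶠ t in 𝓝 (0 : ℝ),
      (((tangentCoordChange (𝓡 4) (c (n, t)) x₀ (c (n, t))).comp
          (mfderiv ((𝓡 3).prod 𝓘(ℝ, ℝ)) (𝓡 4) c (n, t))).comp T :
          EuclideanSpace ℝ (Fin 4) →L[ℝ] EuclideanSpace ℝ (Fin 4)) =
        (fderiv ℝ W (extChartAt (𝓡 3) n n, t)).comp T := by
    filter_upwards [hOt, hDt] with t hto htd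
    congr 1
    -- chain rule `d(φ ∘ c) = dφ ∘ dc`, `dφ = tangentCoordChange`
    have hcd : MDifferentiableAt ((𝓡 3).prod 𝓘(ℝ, ℝ)) (𝓡 4) c (n, t) :=
      hcs.mdifferentiableAt (by norm_num)
    have hφd : MDifferentiableAt (𝓡 4) 𝓘(ℝ, EuclideanSpace ℝ (Fin 4)) φ (c (n, t)) :=
      ((contMDiffOn_extChartAt (n := ∞)).contMDiffAt
        ((chartAt _ x₀).open_source.mem_nhds (by
          have : c (n, t) ∈ φ.source := hto
          rwa [hφ, extChartAt_source] at this))).mdifferentiableAt (by norm_num)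
    have hchain := mfderiv_comp (n, t) hφd hcd
    rw [mfderiv_extChartAt_eq_tangentCoordChange' x₀ (show c (n, t) ∈ φ.source from hto)] at hchain
    -- `mfderiv (φ ∘ c) (n, t) = fderiv W (ψ n, t)`
    have hΦd : MDifferentiableAt ((𝓡 3).prod 𝓘(ℝ, ℝ)) 𝓘(ℝ, EuclideanSpace ℝ (Fin 4)) Φ (n, t) :=
      hφd.comp (n, t) hcd
    have hwritten : writtenInExtChartAt ((𝓡 3).prod 𝓘(ℝ, ℝ)) 𝓘(ℝ, EuclideanSpace ℝ (Fin 4))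
        ((n, t) : N × ℝ) Φ = W := by
      funext y
      rfl
    have hmf : mfderiv ((𝓡 3).prod 𝓘(ℝ, ℝ)) 𝓘(ℝ, EuclideanSpace ℝ (Fin 4)) Φ (n, t) =
        fderiv ℝ W (extChartAt (𝓡 3) n n, t) := by
      rw [hΦd.mfderiv, hwritten, ModelWithCorners.Boundaryless.range_eq_univ (I := (𝓡 3).prod 𝓘(ℝ, ℝ)),
        fderivWithin_univ,
        show extChartAt ((𝓡 3).prod 𝓘(ℝ, ℝ)) ((n, t) : N × ℝ) (n, t) = (extChartAt (𝓡 3) n n, t) from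
          extChartAt_prod_real_apply n n t t]
    have hΦc : mfderiv ((𝓡 3).prod 𝓘(ℝ, ℝ)) 𝓘(ℝ, EuclideanSpace ℝ (Fin 4)) Φ (n, t) =
        (tangentCoordChange (𝓡 4) (c (n, t)) x₀ (c (n, t))).comp
          (mfderiv ((𝓡 3).prod 𝓘(ℝ, ℝ)) (𝓡 4) c (n, t)) := hchain
    exact hΦc.symm.trans hmf
  -- continuity of `t ↦ fderiv W (ψ n, t)` at `0`
  have hWcont : ContinuousOn (fderiv ℝ W) D := hWs.continuousOn_fderiv_of_isOpen hDo (by norm_num)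
  have hWat : ContinuousAt (fun t : ℝ => fderiv ℝ W (extChartAt (𝓡 3) n n, t)) 0 :=
    (hWcont.continuousAt (hDo.mem_nhds hD0)).comp hline.continuousAt
  have hdet : ContinuousAt (fun t : ℝ =>
      LinearMap.det (((fderiv ℝ W (extChartAt (𝓡 3) n n, t)).comp T :
        EuclideanSpace ℝ (Fin 4) →L[ℝ] EuclideanSpace ℝ (Fin 4)) :
        EuclideanSpace ℝ (Fin 4) →ₗ[ℝ] EuclideanSpace ℝ (Fin 4))) 0 := by
    have hc1 : ContinuousAt (fun t : ℝ => (fderiv ℝ W (extChartAt (𝓡 3) n n, t)).comp T) 0 :=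
      (ContinuousLinearMap.precomp (EuclideanSpace ℝ (Fin 4)) T).continuous.continuousAt.comp hWat
    exact ContinuousLinearMap.continuous_det.continuousAt.comp hc1
  refine hdet.congr ?_
  filter_upwards [hframe] with t ht
  rw [← ht]

end FrameDet


/-! ### The first-order coefficient on the null direction -/

section FirstOrder

universe u

/-- **The Pfaffian of a `2`-form in a frame** `T : ℝ⁴ → V`: the Pfaffian of `α ∘ T` is the
Pfaffian combination of the values of `α` on the frame vectors `T e_k`. [folklore] -/
theorem pfaffian_compContinuousLinearMap_eq {V : Type*} [TopologicalSpace V] [AddCommGroup V]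
    [Module ℝ V] (α : V [⋀^Fin 2]→L[ℝ] ℝ) (T : EuclideanSpace ℝ (Fin 4) →L[ℝ] V) :
    pfaffian (α.compContinuousLinearMap T) =
      α ![T (stdVec 0), T (stdVec 1)] * α ![T (stdVec 2), T (stdVec 3)] -
        α ![T (stdVec 0), T (stdVec 2)] * α ![T (stdVec 1), T (stdVec 3)] +
      α ![T (stdVec 0), T (stdVec 3)] * α ![T (stdVec 1), T (stdVec 2)] := by
  have key : ∀ a b : EuclideanSpace ℝ (Fin 4),
      α.compContinuousLinearMap T ![a, b] = α ![T a, T b] := by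
    intro a b
    rw [ContinuousAlternatingMap.compContinuousLinearMap_apply]
    congr 1
    funext i
    fin_cases i <;> rfl
  simp only [pfaffian, key]

variable {M : Type u} [TopologicalSpace M] [T2Space M] [CompactSpace M]
  [ChartedSpace (EuclideanSpace ℝ (Fin 4)) M] [IsManifold (𝓡 4) ∞ M]
variable {N : Type} [TopologicalSpace N] [ChartedSpace (EuclideanSpace ℝ (Fin 3)) N]
  [IsManifold (𝓡 3) ∞ N] {j : N → M} {s : MForm (𝓡 4) M ℝ 2}

/-- **The first-order coefficient of `c^*ω` does not vanish on the null direction** (step (S1b)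
of the unfolding: in the decomposition `c^*ω = A_t + dt ∧ B_t` on the kernel-adapted collar,
`A₀ = j^*ω`, `B₀ = 0`, and `B₁ = ∂ₜ|₀ B_t` satisfies `B₁(X) ≠ 0` for the null direction `X` of
`j^*ω` — the infinitesimal form of "`ω²` vanishes transversally along `Z`", which makes the
Moser model `p^*i^*ω + d(t² p^*α)`, `α(X) = 1`, possible).  For a folded form with fold data
`(N, j)`, a function `f` vanishing on the fold with unit field `U` (level `0`) whose vectors lie
in `ker ω` along the fold, and a non-zero null vector `v` of `(j^*ω)_n`, the function
`t ↦ (c^*ω)_{(n,t)}((0,1), (v,0))` has non-zero derivative at `t = 0`.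
Proof: in a frame `((e₁,0),(e₂,0),(v,0),(0,1))` the Pfaffian `P(t)` of `(c^*ω)_{(n,t)}` has
`P'(0) = -(j^*ω)(e₁,e₂) · ∂ₜ|₀ (c^*ω)((0,1),(v,0))` (`hasDerivAt_pfaffCombination`: five of the
six coefficients vanish at `0`), while `P(t) = det(L t) · Pf(ω.inChart (φ c(n,t)))` with
`det(L t)` continuous and non-zero at `0` and the chart Pfaffian having a simple zero along the
flow line (`IsFoldedForm.hasDerivAt_pfaffian_inChart_fl`), so `P'(0) ≠ 0`.
[cite: CannasdasilvaGuilleminPires2010, Def. 2.1 and proof of Prop. 2.8] -/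
theorem IsFoldedForm.deriv_pullback_foldCollar_ne_zero (h : IsFoldedForm s N j) {f : M → ℝ}
    (U : LevelUnitField 3 f 0) (hf0 : ∀ x ∈ fold s, f x = 0)
    (hU : ∀ x ∈ fold s, ∀ w : TangentSpace (𝓡 4) x, s x ![U.ξ x, w] = 0)
    (n : N) {v : EuclideanSpace ℝ (Fin 3)} (hv : v ≠ 0)
    (hnull : ∀ w : EuclideanSpace ℝ (Fin 3), (s.pullback (𝓡 3) j) n ![v, w] = 0) :
    deriv (fun t : ℝ => (s.pullback ((𝓡 3).prod 𝓘(ℝ, ℝ)) (foldCollar U j)) (n, t)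
      ![((0 : EuclideanSpace ℝ (Fin 3)), (1 : ℝ)), (v, (0 : ℝ))]) 0 ≠ 0 := by
  have hj : ContMDiff (𝓡 3) (𝓡 4) ∞ j := h.embedding.contMDiff
  have hUj : ∀ (m : N) (w : TangentSpace (𝓡 4) (j m)), s (j m) ![U.ξ (j m), w] = 0 :=
    fun m w => hU (j m) (h.range_eq ▸ mem_range_self m) w
  have hΩs : IsSmoothForm (s.pullback ((𝓡 3).prod 𝓘(ℝ, ℝ)) (foldCollar U j)) :=
    isSmoothForm_pullback_foldCollar U hj h.smooth
  -- notation
  set Ω := s.pullback ((𝓡 3).prod 𝓘(ℝ, ℝ)) (foldCollar U j) with hΩ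
  -- an adapted frame
  obtain ⟨T, hTbij, hT0, hT1, hT2, hT3⟩ := exists_adaptedFrame v hv
  have hT0' : T (stdVec 0) = ((T (stdVec 0)).1, (0 : ℝ)) := Prod.ext rfl hT0
  have hT1' : T (stdVec 1) = ((T (stdVec 1)).1, (0 : ℝ)) := Prod.ext rfl hT1
  -- the coefficient functions and their smoothness
  set a : Fin 4 → Fin 4 → ℝ → ℝ := fun k l t => Ω (n, t) ![T (stdVec k), T (stdVec l)] with ha
  have has : ∀ k l, ContDiff ℝ ∞ (a k l) := fun k l => by
    show ContDiff ℝ ∞ (fun t : ℝ => Ω (n, t) ![T (stdVec k), T (stdVec l)])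
    exact contDiff_apply_prod_real hΩs n ![T (stdVec k), T (stdVec l)]
  have had : ∀ k l, HasDerivAt (a k l) (deriv (a k l) 0) 0 := fun k l =>
    (((has k l).differentiable (by simp)) 0).hasDerivAt
  -- values at `t = 0`
  have hinl := pullback_foldCollar_apply_inl_inl U hj n (s := s)
  have hinr := pullback_foldCollar_apply_inr U hj hUj n (s := s)
  have hz : ∀ k l, (k = 0 ∨ k = 1 ∨ k = 2) → l = 3 → a k l 0 = 0 := by
    intro k l hk hl
    subst hl
    show Ω (n, 0) ![T (stdVec k), T (stdVec 3)] = 0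
    rw [hT3, Kaehler.cam₂_swap]
    rcases hk with rfl | rfl | rfl
    · rw [hT0', hinr]; simp
    · rw [hT1', hinr]; simp
    · rw [hT2, hinr]; simp
  have hz02 : a 0 2 0 = 0 := by
    show Ω (n, 0) ![T (stdVec 0), T (stdVec 2)] = 0
    rw [hT0', hT2, hinl, Kaehler.cam₂_swap, hnull, neg_zero]
  have hz12 : a 1 2 0 = 0 := by
    show Ω (n, 0) ![T (stdVec 1), T (stdVec 2)] = 0
    rw [hT1', hT2, hinl, Kaehler.cam₂_swap, hnull, neg_zero]
  -- the frame Pfaffian and its derivative at `0`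
  set P : ℝ → ℝ := fun t => a 0 1 t * a 2 3 t - a 0 2 t * a 1 3 t + a 0 3 t * a 1 2 t with hP
  have hPd : HasDerivAt P (a 0 1 0 * deriv (a 2 3) 0) 0 :=
    hasDerivAt_pfaffCombination (had 0 1) (had 0 2) (had 0 3) (had 1 2) (had 1 3) (had 2 3)
      hz02 hz12 (hz 0 3 (Or.inl rfl) rfl) (hz 1 3 (Or.inr (Or.inl rfl)) rfl)
      (hz 2 3 (Or.inr (Or.inr rfl)) rfl)
  -- the factorisation `P = det (L ·) * g` near `0`
  have hct : ContinuousAt (fun t : ℝ => foldCollar U j (n, t)) 0 :=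
    ((contMDiff_foldCollar U hj).continuous.comp (continuous_const.prodMk continuous_id)).continuousAt
  have hsrc : ∀ᶠ t in 𝓝 (0 : ℝ), foldCollar U j (n, t) ∈ (extChartAt (𝓡 4) (j n)).source := by
    apply hct.preimage_mem_nhds
    rw [foldCollar_zero]
    exact extChartAt_source_mem_nhds (j n)
  have heq : ∀ᶠ t in 𝓝 (0 : ℝ), P t =
      LinearMap.det ((((tangentCoordChange (𝓡 4) (foldCollar U j (n, t)) (j n)
            (foldCollar U j (n, t))).comp
          (mfderiv ((𝓡 3).prod 𝓘(ℝ, ℝ)) (𝓡 4) (foldCollar U j) (n, t))).comp T :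
          EuclideanSpace ℝ (Fin 4) →L[ℝ] EuclideanSpace ℝ (Fin 4)) :
          EuclideanSpace ℝ (Fin 4) →ₗ[ℝ] EuclideanSpace ℝ (Fin 4)) *
        pfaffian (s.inChart (j n) (extChartAt (𝓡 4) (j n) (U.fl (j n) t))) := by
    filter_upwards [hsrc] with t ht
    rw [← foldCollar_apply U j n t, ← pfaffian_frame_eq_det_mul U n t T ht,
      pfaffian_compContinuousLinearMap_eq]
    rfl
  -- the chart Pfaffian along the flow line and the frame determinant
  obtain ⟨g', hg', hgd, hg0⟩ := h.hasDerivAt_pfaffian_inChart_fl U hf0 n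
  have hd := continuousAt_det_frame h U n T
  have hd0 := det_frame_zero_ne_zero h U hf0 n T hTbij
  -- conclusion
  have hp : a 0 1 0 * deriv (a 2 3) 0 ≠ 0 := hasDerivAt_ne_zero_of_eq_mul hPd heq hd hd0 hg0 hgd hg'
  have h23 : a 2 3 = fun t => -(Ω (n, t) ![((0 : EuclideanSpace ℝ (Fin 3)), (1 : ℝ)), (v, (0 : ℝ))]) := by
    funext t
    show Ω (n, t) ![T (stdVec 2), T (stdVec 3)] = _
    rw [hT2, hT3, Kaehler.cam₂_swap]
  have hb : HasDerivAt (fun t : ℝ => Ω (n, t) ![((0 : EuclideanSpace ℝ (Fin 3)), (1 : ℝ)), (v, (0 : ℝ))])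
      (deriv (fun t : ℝ => Ω (n, t) ![((0 : EuclideanSpace ℝ (Fin 3)), (1 : ℝ)), (v, (0 : ℝ))]) 0) 0 :=
    (((contDiff_apply_prod_real hΩs n
      ![((0 : EuclideanSpace ℝ (Fin 3)), (1 : ℝ)), (v, (0 : ℝ))]).differentiable (by simp)) 0).hasDerivAt
  have hderiv23 : deriv (a 2 3) 0 =
      -deriv (fun t : ℝ => Ω (n, t) ![((0 : EuclideanSpace ℝ (Fin 3)), (1 : ℝ)), (v, (0 : ℝ))]) 0 := by
    rw [h23]
    exact hb.neg.deriv
  intro h0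
  apply hp
  rw [hderiv23, h0, neg_zero, mul_zero]

/-- **The origami case: `B₁(X) ≠ 0` for the generator `X` of the null circle action.** For
fold data `(N, j, θ)` of an origami form (free circle action whose orbits are tangent to
`ker ω`, Def. 2.2) the orbit velocity `X_n = d/dt|₀ θ(e^{it}) n` is a non-zero null vector of
`(j^*ω)_n` (the null foliation is the vertical bundle of the null fibration), so the previous
theorem applies: `∂ₜ|₀ (c^*ω)_{(n,t)}((0,1),(X_n,0)) ≠ 0` on the kernel-adapted collar — the
coefficient that step (S1c) rescales to `2 = 2α(X)`.
[cite: CannasdasilvaGuilleminPires2010, Def. 2.2 and proof of Prop. 2.8] -/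
theorem IsFoldedForm.deriv_pullback_foldCollar_orbit_ne_zero (h : IsFoldedForm s N j)
    {θ : Circle → N → N}
    (hθ : ContMDiff ((𝓡 1).prod (𝓡 3)) (𝓡 3) ∞ (fun p : Circle × N => θ p.1 p.2))
    (h1 : ∀ n, θ 1 n = n) (hmul : ∀ a b n, θ (a * b) n = θ a (θ b n))
    (hfree : ∀ a n, θ a n = n → a = 1)
    (htan : ∀ (n : N) (w : TangentSpace (𝓡 4) (j n)),
      s (j n) ![mfderiv 𝓘(ℝ, ℝ) (𝓡 4) (fun t : ℝ => j (θ (Circle.exp t) n)) 0 (1 : ℝ), w] = 0)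
    {f : M → ℝ} (U : LevelUnitField 3 f 0) (hf0 : ∀ x ∈ fold s, f x = 0)
    (hU : ∀ x ∈ fold s, ∀ w : TangentSpace (𝓡 4) x, s x ![U.ξ x, w] = 0) (n : N) :
    deriv (fun t : ℝ => (s.pullback ((𝓡 3).prod 𝓘(ℝ, ℝ)) (foldCollar U j)) (n, t)
      ![((0 : EuclideanSpace ℝ (Fin 3)), (1 : ℝ)),
        ((mfderiv 𝓘(ℝ, ℝ) (𝓡 3) (fun t : ℝ => θ (Circle.exp t) n) 0 (1 : ℝ) :
          EuclideanSpace ℝ (Fin 3)), (0 : ℝ))]) 0 ≠ 0 := by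
  set v : EuclideanSpace ℝ (Fin 3) := mfderiv 𝓘(ℝ, ℝ) (𝓡 3) (fun t : ℝ => θ (Circle.exp t) n) 0 (1 : ℝ)
    with hv
  -- `v ≠ 0`: the fundamental vector field of a free action does not vanish
  have hv0 : v ≠ 0 := by
    intro h0
    apply Literature.Geometry.Manifold.mfderiv_circleOrbit_ne_zero hθ h1 hmul hfree n
    apply ContinuousLinearMap.ext_ring
    exact h0
  -- `v` is null for `j^*ω`: `dj v` is the orbit velocity in `M`, tangent to `ker ω`
  have hnull : ∀ w : EuclideanSpace ℝ (Fin 3), (s.pullback (𝓡 3) j) n ![v, w] = 0 := by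
    intro w
    rw [MForm.pullback_apply]
    have hvec : (fun i => mfderiv (𝓡 3) (𝓡 4) j n ((![v, w] : Fin 2 → EuclideanSpace ℝ (Fin 3)) i)) =
        ![mfderiv 𝓘(ℝ, ℝ) (𝓡 4) (fun t : ℝ => j (θ (Circle.exp t) n)) 0 (1 : ℝ),
          mfderiv (𝓡 3) (𝓡 4) j n w] := by
      funext i
      fin_cases i
      · exact (mfderiv_comp_circleOrbit_apply h.embedding.contMDiff hθ h1 n).symm
      · rfl
    exact (congrArg (s (j n)) hvec).trans (htan n _)
  exact h.deriv_pullback_foldCollar_ne_zero U hf0 hU n hv0 hnull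

end FirstOrder

end Literature.Geometry.Symplectic

end
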